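import Mathlib.AlgebraicGeometry.Morphisms.Proper
import Mathlib.AlgebraicGeometry.Morphisms.UniversallyOpen
import Mathlib.AlgebraicGeometry.PullbackCarrier
import Mathlib.AlgebraicGeometry.FunctionField
import HarnessLib

/-!
# Surjectivity spreads from the generic fibre: a closed morphism into a flat family over an irreducible base that
# covers the generic fibre is surjective

Topic `Literature/AlgebraicGeometry/Limits` (EGA IV₂ §2.3 «morphismes plats et générisations»); namespace
`Literature.AlgebraicGeometry.Limits`.  KERNEL ONLY: theorems; no definition, no named fact, no `sorry`.  Mathlib-only.

Setting: `S` an irreducible scheme with generic point `η`, `q : Y ⟶ S`, `f : X ⟶ Y`.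

* `surjective_of_isClosedMap_of_generalizingMap` — the TOPOLOGICAL CORE: if `f` is a closed map, `q` is generalising
  (generalisations lift along `q`) and every point of the generic fibre `q⁻¹ η` lies in the image of `f`, then `f` is
  surjective.  (The image of `f` is closed, hence stable under specialisation, and every point of `Y` is a
  specialisation of a point of the generic fibre.)
* `surjective_of_forall_genericPoint_mem_range` — the scheme-theoretic dress: `f` universally closed (e.g. `X` proper
  and `Y` separated over `S`, `UniversallyClosed.of_comp_of_isSeparated`) and `q` FLAT (`Flat.generalizingMap`).
* `surjective_of_surjective_of_comm_sq` — BASE-CHANGE PACKAGING: a commutative square `iX ≫ f = f' ≫ iY` with `f'`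
  surjective and `range iY ⊇ q⁻¹ η` supplies the generic-fibre hypothesis — no cartesianness needed.
* `surjective_of_surjective_pullback_map` — the form «`f ×_S S'` surjective for some `g : S' ⟶ S` hitting `η`
  ⇒ `f` surjective» with Mathlib's chosen pullbacks (`pullback.map`), and `surjective_pullback_map_of_surjective` —
  conversely every base change of a surjective `f` is surjective (Mathlib's base-change stability, recorded in the
  same `pullback.map` shape), so that ALL fibres of `f` are then surjective.

Use (cell `hodgecm-mathlib`, row III-0 road F4, A-p14's memo ROAD-III0-albanese-baseChange §1 (S4)): `S = Spec T″` for a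
finitely generated domain `T″ ⊆ ℂ`, `Y = 𝒜` an abelian scheme (flat, separated), `X = Y_{T″}^{2n₀+2}` proper, `f` the
relative sum map of the spread Abel–Jacobi morphism, `S' = Spec ℂ`: surjectivity of the complex sum map spreads to
`T″` and then to every closed fibre.  Nothing beyond EGA IV₂ 2.3.4 is asserted.

## References
* [EGAIV2] A. Grothendieck, J. Dieudonné, EGA IV₂ (Publ. Math. IHÉS 24, 1965), Prop. 2.3.4 (a flat morphism is
  generalising), Cor. 2.3.5.
* [StacksProject] The Stacks Project, Tag 03HV (generalisations lift along flat morphisms), Tag 0CC1.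
-/

set_option autoImplicit false

noncomputable section

universe u

open CategoryTheory CategoryTheory.Limits AlgebraicGeometry TopologicalSpace Topology

namespace Literature.AlgebraicGeometry.Limits

variable {X Y S : Scheme.{u}} (f : X ⟶ Y) (q : Y ⟶ S)

/-- **TOPOLOGICAL CORE.**  `S` irreducible with generic point `η`; `f : X ⟶ Y` a CLOSED map, `q : Y ⟶ S` GENERALISING
(generalisations of `q y` lift to generalisations of `y`), and every point of the generic fibre `{y | q y = η}` in the
image of `f`.  Then `f` is surjective: the image of `f` is closed, hence specialisation-stable, and every `y` specialises
from a point `y'` of the generic fibre (`η ⤳ q y` lifts). [cite: EGAIV2, Prop. 2.3.4, Cor. 2.3.5] [cite: StacksProject, Tag 03HV] -/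
theorem surjective_of_isClosedMap_of_generalizingMap [IrreducibleSpace S] (hf : IsClosedMap f)
    (hq : GeneralizingMap q) (hgen : ∀ y : Y, q y = genericPoint S → y ∈ Set.range f) :
    Surjective f := by
  refine ⟨fun y => ?_⟩
  -- a generalisation `y'` of `y` lying over the generic point
  obtain ⟨y', hy'y, hqy'⟩ := hq (a := y) (b := genericPoint S) (genericPoint_specializes (q y))
  -- `y'` is in the closed image of `f`, hence so is its specialisation `y`
  have hclosed : IsClosed (Set.range f) := hf.isClosed_range
  exact hy'y.mem_closed hclosed (hgen y' hqy')

/-- **SURJECTIVITY SPREADS FROM THE GENERIC FIBRE.**  `S` irreducible; `f : X ⟶ Y` universally closed (e.g. `X ⟶ S`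
proper and `Y ⟶ S` separated); `q : Y ⟶ S` flat.  If every point of `Y` over the generic point of `S` is in the image
of `f`, then `f` is surjective. [cite: EGAIV2, Prop. 2.3.4, Cor. 2.3.5] [cite: StacksProject, Tag 03HV] -/
theorem surjective_of_forall_genericPoint_mem_range [IrreducibleSpace S] [UniversallyClosed f] [Flat q]
    (hgen : ∀ y : Y, q y = genericPoint S → y ∈ Set.range f) : Surjective f :=
  surjective_of_isClosedMap_of_generalizingMap f q f.isClosedMap (Flat.generalizingMap q) hgen

/-- the same with the properness bookkeeping done: `p : X ⟶ S` proper, `q : Y ⟶ S` separated and flat, `f ≫ q = p`.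
[cite: EGAIV2, Prop. 2.3.4, Cor. 2.3.5] -/
theorem surjective_of_forall_genericPoint_mem_range_of_isProper [IrreducibleSpace S] (p : X ⟶ S) [IsProper p]
    [IsSeparated q] [Flat q] (hp : f ≫ q = p)
    (hgen : ∀ y : Y, q y = genericPoint S → y ∈ Set.range f) : Surjective f := by
  haveI : UniversallyClosed (f ≫ q) := by rw [hp]; infer_instance
  haveI : UniversallyClosed f := UniversallyClosed.of_comp_of_isSeparated f q
  exact surjective_of_forall_genericPoint_mem_range f q hgen

/-- **BASE-CHANGE PACKAGING (any commutative square).**  If `iX ≫ f = f' ≫ iY` with `f'` surjective and the image of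
`iY` containing the generic fibre of `q`, then (with `f` universally closed and `q` flat) `f` is surjective.  Typical
use: `iY : Y ×_S S' ⟶ Y`, `f' = f ×_S S'` for some `S' ⟶ S` whose image contains the generic point.
[cite: EGAIV2, Prop. 2.3.4, Cor. 2.3.5] -/
theorem surjective_of_surjective_of_comm_sq [IrreducibleSpace S] [UniversallyClosed f] [Flat q]
    {X' Y' : Scheme.{u}} (iX : X' ⟶ X) (iY : Y' ⟶ Y) (f' : X' ⟶ Y') (hsq : iX ≫ f = f' ≫ iY) [Surjective f']
    (hη : ∀ y : Y, q y = genericPoint S → y ∈ Set.range iY) : Surjective f := by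
  refine surjective_of_forall_genericPoint_mem_range f q fun y hy => ?_
  obtain ⟨y', rfl⟩ := hη y hy
  obtain ⟨x', rfl⟩ := f'.surjective y'
  refine ⟨iX x', ?_⟩
  rw [← Scheme.Hom.comp_apply, hsq, Scheme.Hom.comp_apply]

variable {S' : Scheme.{u}} (g : S' ⟶ S)

/-- **`f ×_S S'` surjective for one `S' ⟶ S` hitting the generic point ⇒ `f` surjective** (Mathlib's chosen pullbacks:
the base change of `f` along `g` is `pullback.map (f ≫ q) g q g f (𝟙 S') (𝟙 S) _ _ : X ×_S S' ⟶ Y ×_S S'`); `f` universally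
closed, `q` flat, `S` irreducible. [cite: EGAIV2, Prop. 2.3.4, Cor. 2.3.5] [cite: StacksProject, Tag 03HV] -/
theorem surjective_of_surjective_pullback_map [IrreducibleSpace S] [UniversallyClosed f] [Flat q]
    (hg : genericPoint S ∈ Set.range g)
    [Surjective (pullback.map (f ≫ q) g q g f (𝟙 S') (𝟙 S) (Category.comp_id _)
      ((Category.comp_id g).trans (Category.id_comp g).symm))] :
    Surjective f := by
  refine surjective_of_surjective_of_comm_sq f q (pullback.fst (f ≫ q) g) (pullback.fst q g)
    (pullback.map (f ≫ q) g q g f (𝟙 S') (𝟙 S) (Category.comp_id _)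
      ((Category.comp_id g).trans (Category.id_comp g).symm))
    (pullback.lift_fst _ _ _).symm fun y hy => ?_
  rw [Scheme.Pullback.range_fst]
  show q y ∈ Set.range g
  rwa [hy]

/-- … and conversely every base change of a surjective morphism is surjective (Mathlib's base-change stability of
`Surjective`, in the same `pullback.map` shape), so all fibres of `f` are surjective once `f` is.
[cite: StacksProject, Tag 0CC1] -/
theorem surjective_pullback_map_of_surjective [Surjective f] :
    Surjective (pullback.map (f ≫ q) g q g f (𝟙 S') (𝟙 S) (Category.comp_id _)
      ((Category.comp_id g).trans (Category.id_comp g).symm)) := by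
  -- `X ×_S S' ⟶ Y ×_S S'` is the pullback of `f` along `Y ×_S S' ⟶ Y` (pasting of pullback squares)
  have e1 : pullback.map (f ≫ q) g q g f (𝟙 S') (𝟙 S) (Category.comp_id _)
      ((Category.comp_id g).trans (Category.id_comp g).symm) ≫ pullback.snd q g =
      pullback.snd (f ≫ q) g := by
    rw [pullback.lift_snd, Category.comp_id]
  have hbig : IsPullback (pullback.map (f ≫ q) g q g f (𝟙 S') (𝟙 S) (Category.comp_id _)
      ((Category.comp_id g).trans (Category.id_comp g).symm) ≫ pullback.snd q g)
      (pullback.fst (f ≫ q) g) g (f ≫ q) := by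
    rw [e1]
    exact (IsPullback.of_hasPullback (f ≫ q) g).flip
  have hpb : IsPullback (pullback.map (f ≫ q) g q g f (𝟙 S') (𝟙 S) (Category.comp_id _)
      ((Category.comp_id g).trans (Category.id_comp g).symm))
      (pullback.fst (f ≫ q) g) (pullback.fst q g) f :=
    IsPullback.of_right hbig (pullback.lift_fst _ _ _) (IsPullback.of_hasPullback q g).flip
  exact MorphismProperty.of_isPullback (P := @Surjective) hpb.flip inferInstance


/-! ### The affine-domain form: `S = Spec R`, `S' = Spec K`, `R → K` injective -/

/-- for an injective ring map `φ : R → K` from a domain into a field, `Spec K → Spec R` hits the generic point of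
`Spec R` (the image of the point of `Spec K` is the prime `ker φ = 0`). [cite: EGAIV2, Prop. 2.3.4] -/
theorem genericPoint_mem_range_SpecMap {R K : Type u} [CommRing R] [IsDomain R] [Field K] (φ : R →+* K)
    (hφ : Function.Injective φ) :
    genericPoint (Spec (CommRingCat.of R)) ∈ Set.range (Spec.map (CommRingCat.ofHom φ)) := by
  refine ⟨(⊥ : PrimeSpectrum K), ?_⟩
  rw [genericPoint_eq_bot_of_affine, Spec.map_apply]
  apply PrimeSpectrum.ext
  change Ideal.comap φ (⊥ : Ideal K) = ⊥
  exact Ideal.comap_bot_of_injective φ hφ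

/-- **F4, affine-domain form.**  `R` a domain, `φ : R → K` an injective ring map into a field (e.g. a finitely generated
subring `T″ ⊆ ℂ` and its inclusion), `q : Y ⟶ Spec R` flat, `f : X ⟶ Y` universally closed (e.g. `X` proper and `Y`
separated over `Spec R`).  If the base change `f ×_{Spec R} Spec K` is surjective, then `f` is surjective — and hence
(`surjective_pullback_map_of_surjective`) so is every base change of `f`, in particular every fibre over `Spec R`.
[cite: EGAIV2, Prop. 2.3.4, Cor. 2.3.5] [cite: StacksProject, Tag 03HV] -/
theorem surjective_of_surjective_pullback_map_SpecMap {R K : Type u} [CommRing R] [IsDomain R] [Field K]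
    (φ : R →+* K) (hφ : Function.Injective φ) {X Y : Scheme.{u}} (f : X ⟶ Y) (q : Y ⟶ Spec (CommRingCat.of R))
    [UniversallyClosed f] [Flat q]
    [Surjective (pullback.map (f ≫ q) (Spec.map (CommRingCat.ofHom φ)) q (Spec.map (CommRingCat.ofHom φ)) f
      (𝟙 _) (𝟙 _) (Category.comp_id _)
      ((Category.comp_id (Spec.map (CommRingCat.ofHom φ))).trans
        (Category.id_comp (Spec.map (CommRingCat.ofHom φ))).symm))] :
    Surjective f :=
  haveI : IrreducibleSpace (Spec (CommRingCat.of R)) := PrimeSpectrum.irreducibleSpace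
  surjective_of_surjective_pullback_map f q (Spec.map (CommRingCat.ofHom φ)) (genericPoint_mem_range_SpecMap φ hφ)

end Literature.AlgebraicGeometry.Limits

end
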